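import Summits.QuantumFields.YangMills.Theorems.AlphaInputsT3ACv3EMLIterFirstOrderUniform
import Summits.QuantumFields.YangMills.Theorems.AlphaInputsT3ACv3PerturbedPlaquette
import HarnessLib

/-!
# `AlphaInputsT3ACv3SymAvgPlaqAssembly` — (O″χ) block B1, the (α) seam re-read as (69)_sym ∕ (71)_sym (★★OWNER RULING g26-№13 (ii), R-ii): piece **(iii) PLAQUETTE
# ASSEMBLY + FINE PLAQUETTES** of ★w6-19936 g2's LOCATE (`LOCATE-alpha-seam-w6-g2.md` 44fcc0efa923e0a2 §2) — **the four near-identity bond variables around a plaquette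
# compose to FIRST ORDER into the curl of their first-order data, with a SECOND-ORDER remainder `4r + 13m²`; read on the `s`-fold (0.4)-average of record it gives
# `|Ū^{(s)}(∂p′) − 1| ≤ |curl(Q^{(s)}Y)(p′)| + (4C + 52)·m_s²` with the `k`-UNIFORM `C = 324L(d+2)²` of ✓ `EMLIterUniform`, and read on the finest field it gives
# `|curl Y(p)| ≤ |U(∂p) − 1| + 13δ²` per fine plaquette** — lane `pub-balaban3d` ∕ cell `ym3-torus`, width seat `ym-ust-19936-w7` (g3)

WHY (cell `ym3-torus` bus 2026-08-28: ★★OWNER RULING g26-№8 (1)(α) ∕ №13 (ii); ★w6-19936 g2 LOCATE §0–§2; ★alpha-2 g7 07:46:23Z).  The seam row of (O″χ) B1 compares the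
RECORDING currency of (67) — `dist1` of the plaquette variable of the `j`-fold SYMMETRIC average `(blockAvg ℰp)^j Ũ` (`AlphaInputsT3AC.large67RecSet`) — with the sum of
fine plaquette deviations that (70)–(71) of [Balaban1985UV3] consume.  Print's (69) does this for the COMB average ([Balaban1985Averaging] (42)–(43)); for the symmetric
average the two-sided first order is `Ū^{(j)}(∂p′) − 1 = Λ_j + O(α₀²)` with the SAME rigid flux `Λ_j` (LOCATE §2).  Of its four pieces, (ii) — the `k`-uniform second order of
the bond variables — is ✓ `EMLIterUniform.norm_iter_sub_one_sub_iterLin_le_uniform` (fed by the gauge clamp, ★w2-19936 g4), (i) — the rigid flux of the iterated linearised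
average — is ★w6-19936 g2's `…LinAvgIterFluxRigid`, and THIS FILE is (iii): the passage from BOND variables to PLAQUETTE variables at both ends (coarse: the average's plaquette
vs the curl of `Q^{(s)}Y`; fine: `curl Y` vs the field's own plaquette), plus the summed fine bound and the (69)_sym knit MODULO the rigid-flux identity, displayed as a norm
inequality `hflux` so that piece (i) plugs in by name whatever index set it chooses.
WHAT (def-free; generic torus `P : Params`, generic `SU(N)`, every level, BOTH orientations `(y; μ, ν)` — `GaugeField.plaqHol U p` is the case `(p.src; p.μ, p.ν)` by `rfl`).
* §1 normed-ring letters: `mul_four_sub_one_sub_sum_eq` (the exact expansion of `x₁x₂x₃x₄ − 1 − Σ(xᵢ − 1)` into the 11 products of the `xᵢ − 1`), ★ `norm_mul_four_sub_one_sub_sum_le`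
  (`≤ 6m² + 4m³ + m⁴ ≤ 11m²`), and the UNITARY INVERSE to second order `(W* − 1) + (W − 1) = −(W* − 1)(W − 1)`, `‖(W* − 1) + (W − 1)‖ ≤ ‖W − 1‖²` (`star_sub_one_add_sub_one_eq`,
  `norm_star_sub_one_add_le_sq`); letters of ✓ `…v3PerturbedPlaquette` (`dist1_SU_eq`) and LQB (`norm_star`) are used BY NAME.
* §2 ★★ `norm_plaqProd_sub_one_sub_curl_le`: for an `SU(N)` field `V` with `‖V(b) − 1‖ ≤ m ≤ 1` and first-order data `‖V(b) − 1 − Z(b)‖ ≤ r` on the four bonds of `(y; μ, ν)`,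
  `‖V(y,μ)V(y+e_μ,ν)V(y+e_ν,μ)⁻¹V(y,ν)⁻¹ − 1 − (Z(y,μ) + Z(y+e_μ,ν) − Z(y+e_ν,μ) − Z(y,ν))‖ ≤ 4r + 13m²`; `plaqHol` reading; the two `dist1` companions; the FINE case `Z = V − 1`,
  `r = 0`: ★ `norm_fineCurl_le_dist1_add` (`‖Y₁ + Y₂ − Y₃ − Y₄‖ ≤ |U(∂p) − 1| + 13δ²`), and its sum over any finite family of fine plaquettes (`norm_sum_fineCurl_le`).
* §3 ★★ `norm_plaqProd_iter_sub_one_sub_curl_le_uniform`: under EXACTLY the hypotheses of ✓ `EMLIterUniform.norm_iter_sub_one_sub_iterLin_le_uniform` (any `Q` with `Q 0 = id`,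
  `Q (s+1) Y c = linAvg (Q s Y) c`; `d + 2 ≤ L`; `‖U_b − 1‖ ≤ δ`; the ONE window on `m_k`), for every `s ≤ k` and every level-`s` plaquette (either orientation):
  `‖Ū^{(s)}(∂p′) − 1 − curl(Q^{(s)}Y)(p′)‖ ≤ (4·324L(d+2)² + 52)·m_s²`, `m_s = 2|n|²(d+1)L^sδ` — `k`-UNIFORM; `dist1` companion ★ `dist1_plaqHol_iter_le_uniform`.
* §4 ★★ `dist1_plaqHol_iter_le_of_flux` — (69)_sym MODULO THE RIGID FLUX: if `‖curl(Q^{(s)}Y)(p′)‖ ≤ w·Σ_{t∈T} ‖curl Y(π t)‖` (piece (i), displayed; any finite index set `T`, any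
  weight `w ≥ 0`), then `|Ū^{(s)}(∂p′) − 1| ≤ w·Σ_{t∈T} |U(∂(π t)) − 1| + 13·w·|T|·δ² + (4·324L(d+2)² + 52)·m_s²` — with print's `w = L^{−ds}`, `|T| = L^{ds}·L^{2s}` the middle term is
  `13·(L^sδ)²`, so every remainder is on the natural scale `L^sδ ≍ α₀` and `s`-FREE, as (69) requires.
HONEST FRAMING.  Elementary normed-algebra bookkeeping over the tree's (0.4)-averaging letters at the FLAT gauge (the clamp that puts a read-regular `Ũ` into this gauge is piece
(ii), not here; the rigid-flux identity is piece (i), displayed here as `hflux`); nothing of [Balaban1985UV3] (69)–(71) is asserted beyond these letters; the seam row, B1, the stub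
`stub_laneRecordsV3Chi`, the crux `HistoryTailL` and any gap are NOT closed; count-neutral helper (`--supports stmt-QuantumFields-19936`); registry untouched.  YM₃ on the
three-torus is rung R3 of the programme (finite-torus SU(2)), not the Clay problem: nothing here is about d = 4, infinite volume, the continuum, or a mass gap.

References: T. Bałaban, Commun. Math. Phys. 102 (1985) 255–275 [Balaban1985UV3] ((67)–(71) p.273); Commun. Math. Phys. 98 (1985) 17–51 [Balaban1985Averaging] ((8)–(9) pp.18–19,
(19) p.21, Prop. 1 (48)–(51) pp.25–26, Prop. 4 (134)–(135) p.38); Commun. Math. Phys. 109 (1987) 249–301 [Balaban1987RG1] ((0.4) p.253).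
-/

set_option autoImplicit false

noncomputable section

open scoped Matrix.Norms.L2Operator BigOperators

namespace Summit.QuantumFields.YangMills.Theorems.SymAvgPlaqAssembly

open Literature.MathematicalPhysics.QuantumFieldTheory.Balaban1983to89
open T4Continuum AveragingRT BlockAveraging ExpMeanLog BlockAveragingEMLLinearised
open Literature.MathematicalPhysics.QuantumLattice (coe_inv_eq_star)
open Summit.QuantumFields.YangMills.Theorems.EMLIterUniform (main_scale_mono norm_iter_sub_one_sub_iterLin_le_uniform)
open Summit.QuantumFields.YangMills.Theorems.PerturbedPlaquette (dist1_SU_eq)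

/-! ## §1 Normed-ring letters: four near-identity factors to second order; the unitary inverse to second order -/

section Algebra

variable {𝔸 : Type*} [NormedRing 𝔸]

/-- The exact expansion `x₁x₂x₃x₄ − 1 − Σ(xᵢ − 1) = Σ_{i<j} yᵢyⱼ + Σ_{i<j<l} yᵢyⱼy_l + y₁y₂y₃y₄`, `yᵢ = xᵢ − 1` (order of factors kept). [folklore] -/
theorem mul_four_sub_one_sub_sum_eq (x₁ x₂ x₃ x₄ : 𝔸) :
    x₁ * x₂ * x₃ * x₄ - 1 - ((x₁ - 1) + (x₂ - 1) + (x₃ - 1) + (x₄ - 1)) =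
      (x₁ - 1) * (x₂ - 1) + (x₁ - 1) * (x₃ - 1) + (x₁ - 1) * (x₄ - 1) + (x₂ - 1) * (x₃ - 1) + (x₂ - 1) * (x₄ - 1) + (x₃ - 1) * (x₄ - 1) +
      ((x₁ - 1) * (x₂ - 1) * (x₃ - 1) + (x₁ - 1) * (x₂ - 1) * (x₄ - 1) + (x₁ - 1) * (x₃ - 1) * (x₄ - 1) + (x₂ - 1) * (x₃ - 1) * (x₄ - 1)) +
      (x₁ - 1) * (x₂ - 1) * (x₃ - 1) * (x₄ - 1) := by
  noncomm_ring

/-- **★ FOUR NEAR-IDENTITY FACTORS TO SECOND ORDER**: `‖xᵢ − 1‖ ≤ m` (`i = 1,…,4`) ⇒ `‖x₁x₂x₃x₄ − 1 − Σ(xᵢ − 1)‖ ≤ 6m² + 4m³ + m⁴`. [folklore] -/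
theorem norm_mul_four_sub_one_sub_sum_le (x₁ x₂ x₃ x₄ : 𝔸) {m : ℝ}
    (h₁ : ‖x₁ - 1‖ ≤ m) (h₂ : ‖x₂ - 1‖ ≤ m) (h₃ : ‖x₃ - 1‖ ≤ m) (h₄ : ‖x₄ - 1‖ ≤ m) :
    ‖x₁ * x₂ * x₃ * x₄ - 1 - ((x₁ - 1) + (x₂ - 1) + (x₃ - 1) + (x₄ - 1))‖ ≤ 6 * m ^ 2 + 4 * m ^ 3 + m ^ 4 := by
  have hm : 0 ≤ m := (norm_nonneg _).trans h₁
  rw [mul_four_sub_one_sub_sum_eq]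
  -- generic product bounds
  have p2 : ∀ {a b : 𝔸}, ‖a‖ ≤ m → ‖b‖ ≤ m → ‖a * b‖ ≤ m ^ 2 := fun ha hb =>
    (norm_mul_le _ _).trans (by rw [sq]; exact mul_le_mul ha hb (norm_nonneg _) hm)
  have p3 : ∀ {a b c : 𝔸}, ‖a‖ ≤ m → ‖b‖ ≤ m → ‖c‖ ≤ m → ‖a * b * c‖ ≤ m ^ 3 := fun ha hb hc =>
    (norm_mul_le _ _).trans (by
      rw [pow_succ]; exact mul_le_mul (p2 ha hb) hc (norm_nonneg _) (by positivity))
  have p4 : ∀ {a b c e : 𝔸}, ‖a‖ ≤ m → ‖b‖ ≤ m → ‖c‖ ≤ m → ‖e‖ ≤ m → ‖a * b * c * e‖ ≤ m ^ 4 := fun ha hb hc he =>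
    (norm_mul_le _ _).trans (by
      rw [pow_succ]; exact mul_le_mul (p3 ha hb hc) he (norm_nonneg _) (by positivity))
  refine (norm_add₃_le).trans ?_
  have s2 : ‖(x₁ - 1) * (x₂ - 1) + (x₁ - 1) * (x₃ - 1) + (x₁ - 1) * (x₄ - 1) + (x₂ - 1) * (x₃ - 1) + (x₂ - 1) * (x₄ - 1) + (x₃ - 1) * (x₄ - 1)‖ ≤
      6 * m ^ 2 := by
    have := norm_add_le_of_le (norm_add_le_of_le (norm_add_le_of_le (norm_add_le_of_le (norm_add_le_of_le (p2 h₁ h₂) (p2 h₁ h₃)) (p2 h₁ h₄))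
      (p2 h₂ h₃)) (p2 h₂ h₄)) (p2 h₃ h₄)
    linarith
  have s3 : ‖(x₁ - 1) * (x₂ - 1) * (x₃ - 1) + (x₁ - 1) * (x₂ - 1) * (x₄ - 1) + (x₁ - 1) * (x₃ - 1) * (x₄ - 1) + (x₂ - 1) * (x₃ - 1) * (x₄ - 1)‖ ≤
      4 * m ^ 3 := by
    have := norm_add_le_of_le (norm_add_le_of_le (norm_add_le_of_le (p3 h₁ h₂ h₃) (p3 h₁ h₂ h₄)) (p3 h₁ h₃ h₄)) (p3 h₂ h₃ h₄)
    linarith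
  have s4 : ‖(x₁ - 1) * (x₂ - 1) * (x₃ - 1) * (x₄ - 1)‖ ≤ m ^ 4 := p4 h₁ h₂ h₃ h₄
  linarith

/-- `6m² + 4m³ + m⁴ ≤ 11m²` for `0 ≤ m ≤ 1`. [folklore] -/
theorem six_four_one_le_eleven_sq {m : ℝ} (hm : 0 ≤ m) (hm1 : m ≤ 1) : 6 * m ^ 2 + 4 * m ^ 3 + m ^ 4 ≤ 11 * m ^ 2 := by
  have h3 : m ^ 3 ≤ m ^ 2 := by
    rw [pow_succ]; exact mul_le_of_le_one_right (by positivity) hm1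
  have h4 : m ^ 4 ≤ m ^ 2 := by
    have : m ^ 4 = m ^ 2 * m ^ 2 := by ring
    rw [this]; exact mul_le_of_le_one_right (by positivity) (by nlinarith)
  linarith

variable [StarRing 𝔸] [CStarRing 𝔸]

omit [CStarRing 𝔸] in
/-- **THE UNITARY INVERSE TO SECOND ORDER, EXACTLY**: for unitary `W`, `(W* − 1) + (W − 1) = −(W* − 1)(W − 1)`. [folklore] -/
theorem star_sub_one_add_sub_one_eq {W : 𝔸} (hW : W ∈ unitary 𝔸) :
    (star W - 1) + (W - 1) = -((star W - 1) * (W - 1)) := by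
  have h := Unitary.star_mul_self_of_mem hW
  have e : (star W - 1) * (W - 1) = star W * W - star W - W + 1 := by noncomm_ring
  rw [e, h]
  abel

/-- Hence `‖(W* − 1) + (W − 1)‖ ≤ ‖W − 1‖²`: the inverse of a near-identity unitary is `1 − (W − 1)` to second order. [folklore] -/
theorem norm_star_sub_one_add_le_sq {W : 𝔸} (hW : W ∈ unitary 𝔸) : ‖(star W - 1) + (W - 1)‖ ≤ ‖W - 1‖ ^ 2 := by
  have hst : ‖star W - 1‖ = ‖W - 1‖ := by rw [← norm_star (W - 1), star_sub, star_one]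
  rw [star_sub_one_add_sub_one_eq hW, norm_neg, sq]
  exact (norm_mul_le _ _).trans (by rw [hst])

end Algebra

/-! ## §2 The plaquette variable of four near-identity `SU(N)` bond variables, to second order about first-order data -/

section Plaquette

variable {P : Params} {j : ℕ} {n : Type*} [Fintype n] [DecidableEq n] [Nonempty n]

omit [Nonempty n] in
/-- **★★ PLAQUETTE ASSEMBLY TO SECOND ORDER** (either orientation `(y; μ, ν)`, any level, any `SU(N)`): if the four bond variables of `V` around `(y; μ, ν)` satisfy `‖V(b) − 1‖ ≤ m ≤ 1`
and carry first-order data `Z` with `‖V(b) − 1 − Z(b)‖ ≤ r`, then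
`‖V(y,μ)·V(y+e_μ,ν)·V(y+e_ν,μ)⁻¹·V(y,ν)⁻¹ − 1 − (Z(y,μ) + Z(y+e_μ,ν) − Z(y+e_ν,μ) − Z(y,ν))‖ ≤ 4r + 13m²`
(`11m²` from the four-factor expansion, `2m²` from the two inverted slots `V⁻¹ − 1 = −(V − 1) + O(m²)`). [cite: Balaban1985Averaging, (8)–(9) pp.18–19, (19) p.21] -/
theorem norm_plaqProd_sub_one_sub_curl_le (V : GaugeField P j (Matrix.specialUnitaryGroup n ℂ)) (Z : PBond P j → Matrix n n ℂ)
    (y : Site P j) (μ ν : Fin P.d) {m r : ℝ} (hm1 : m ≤ 1)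
    (h₁ : ‖((V ⟨y, μ⟩ : Matrix.specialUnitaryGroup n ℂ) : Matrix n n ℂ) - 1‖ ≤ m)
    (h₂ : ‖((V ⟨y.shift μ, ν⟩ : Matrix.specialUnitaryGroup n ℂ) : Matrix n n ℂ) - 1‖ ≤ m)
    (h₃ : ‖((V ⟨y.shift ν, μ⟩ : Matrix.specialUnitaryGroup n ℂ) : Matrix n n ℂ) - 1‖ ≤ m)
    (h₄ : ‖((V ⟨y, ν⟩ : Matrix.specialUnitaryGroup n ℂ) : Matrix n n ℂ) - 1‖ ≤ m)
    (g₁ : ‖((V ⟨y, μ⟩ : Matrix.specialUnitaryGroup n ℂ) : Matrix n n ℂ) - 1 - Z ⟨y, μ⟩‖ ≤ r)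
    (g₂ : ‖((V ⟨y.shift μ, ν⟩ : Matrix.specialUnitaryGroup n ℂ) : Matrix n n ℂ) - 1 - Z ⟨y.shift μ, ν⟩‖ ≤ r)
    (g₃ : ‖((V ⟨y.shift ν, μ⟩ : Matrix.specialUnitaryGroup n ℂ) : Matrix n n ℂ) - 1 - Z ⟨y.shift ν, μ⟩‖ ≤ r)
    (g₄ : ‖((V ⟨y, ν⟩ : Matrix.specialUnitaryGroup n ℂ) : Matrix n n ℂ) - 1 - Z ⟨y, ν⟩‖ ≤ r) :
    ‖((V ⟨y, μ⟩ * V ⟨y.shift μ, ν⟩ * (V ⟨y.shift ν, μ⟩)⁻¹ * (V ⟨y, ν⟩)⁻¹ : Matrix.specialUnitaryGroup n ℂ) : Matrix n n ℂ) - 1 -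
        (Z ⟨y, μ⟩ + Z ⟨y.shift μ, ν⟩ - Z ⟨y.shift ν, μ⟩ - Z ⟨y, ν⟩)‖ ≤ 4 * r + 13 * m ^ 2 := by
  have hm : 0 ≤ m := (norm_nonneg _).trans h₁
  -- names
  set V₁ : Matrix n n ℂ := ((V ⟨y, μ⟩ : Matrix.specialUnitaryGroup n ℂ) : Matrix n n ℂ) with hV₁
  set V₂ : Matrix n n ℂ := ((V ⟨y.shift μ, ν⟩ : Matrix.specialUnitaryGroup n ℂ) : Matrix n n ℂ) with hV₂
  set V₃ : Matrix n n ℂ := ((V ⟨y.shift ν, μ⟩ : Matrix.specialUnitaryGroup n ℂ) : Matrix n n ℂ) with hV₃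
  set V₄ : Matrix n n ℂ := ((V ⟨y, ν⟩ : Matrix.specialUnitaryGroup n ℂ) : Matrix n n ℂ) with hV₄
  have hW : ((V ⟨y, μ⟩ * V ⟨y.shift μ, ν⟩ * (V ⟨y.shift ν, μ⟩)⁻¹ * (V ⟨y, ν⟩)⁻¹ : Matrix.specialUnitaryGroup n ℂ) : Matrix n n ℂ) =
      V₁ * V₂ * star V₃ * star V₄ := by
    simp only [Submonoid.coe_mul, coe_inv_eq_star, hV₁, hV₂, hV₃, hV₄]
  have hu₃ : V₃ ∈ unitary (Matrix n n ℂ) := (V ⟨y.shift ν, μ⟩).2.1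
  have hu₄ : V₄ ∈ unitary (Matrix n n ℂ) := (V ⟨y, ν⟩).2.1
  -- second-order pieces
  have hst : ∀ X : Matrix n n ℂ, ‖star X - 1‖ = ‖X - 1‖ := fun X => by
    rw [← norm_star (X - 1), star_sub, star_one]
  have h₃' : ‖star V₃ - 1‖ ≤ m := by rw [hst]; exact h₃
  have h₄' : ‖star V₄ - 1‖ ≤ m := by rw [hst]; exact h₄
  have hR := norm_mul_four_sub_one_sub_sum_le V₁ V₂ (star V₃) (star V₄) h₁ h₂ h₃' h₄'
  have hR' : ‖V₁ * V₂ * star V₃ * star V₄ - 1 - ((V₁ - 1) + (V₂ - 1) + (star V₃ - 1) + (star V₄ - 1))‖ ≤ 11 * m ^ 2 :=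
    hR.trans (six_four_one_le_eleven_sq hm hm1)
  have hS₃ : ‖(star V₃ - 1) + (V₃ - 1)‖ ≤ m ^ 2 :=
    (norm_star_sub_one_add_le_sq hu₃).trans (by rw [sq, sq]; exact mul_le_mul h₃ h₃ (norm_nonneg _) hm)
  have hS₄ : ‖(star V₄ - 1) + (V₄ - 1)‖ ≤ m ^ 2 :=
    (norm_star_sub_one_add_le_sq hu₄).trans (by rw [sq, sq]; exact mul_le_mul h₄ h₄ (norm_nonneg _) hm)
  rw [hW]
  have e : V₁ * V₂ * star V₃ * star V₄ - 1 - (Z ⟨y, μ⟩ + Z ⟨y.shift μ, ν⟩ - Z ⟨y.shift ν, μ⟩ - Z ⟨y, ν⟩) =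
      (V₁ * V₂ * star V₃ * star V₄ - 1 - ((V₁ - 1) + (V₂ - 1) + (star V₃ - 1) + (star V₄ - 1))) +
        (((star V₃ - 1) + (V₃ - 1)) + ((star V₄ - 1) + (V₄ - 1))) +
        (((V₁ - 1 - Z ⟨y, μ⟩) + (V₂ - 1 - Z ⟨y.shift μ, ν⟩)) - ((V₃ - 1 - Z ⟨y.shift ν, μ⟩) + (V₄ - 1 - Z ⟨y, ν⟩))) := by
    abel
  rw [e]
  refine (norm_add₃_le).trans ?_
  have t2 : ‖((star V₃ - 1) + (V₃ - 1)) + ((star V₄ - 1) + (V₄ - 1))‖ ≤ m ^ 2 + m ^ 2 := norm_add_le_of_le hS₃ hS₄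
  have t3 : ‖((V₁ - 1 - Z ⟨y, μ⟩) + (V₂ - 1 - Z ⟨y.shift μ, ν⟩)) - ((V₃ - 1 - Z ⟨y.shift ν, μ⟩) + (V₄ - 1 - Z ⟨y, ν⟩))‖ ≤ (r + r) + (r + r) :=
    norm_sub_le_of_le (norm_add_le_of_le g₁ g₂) (norm_add_le_of_le g₃ g₄)
  linarith

/-- The same for the positively oriented plaquette `p` of the tree (`GaugeField.plaqHol`, over the tree's `GaugeGroup SU(N)` instance). [cite: Balaban1985Averaging, (9) p.19] -/
theorem norm_plaqHol_sub_one_sub_curl_le (V : GaugeField P j (Matrix.specialUnitaryGroup n ℂ)) (Z : PBond P j → Matrix n n ℂ)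
    (p : Plaq P j) {m r : ℝ} (hm1 : m ≤ 1)
    (hV : ∀ b : PBond P j, ‖((V b : Matrix.specialUnitaryGroup n ℂ) : Matrix n n ℂ) - 1‖ ≤ m)
    (hZ : ∀ b : PBond P j, ‖((V b : Matrix.specialUnitaryGroup n ℂ) : Matrix n n ℂ) - 1 - Z b‖ ≤ r) :
    ‖((GaugeField.plaqHol V p : Matrix.specialUnitaryGroup n ℂ) : Matrix n n ℂ) - 1 -
        (Z ⟨p.src, p.μ⟩ + Z ⟨p.src.shift p.μ, p.ν⟩ - Z ⟨p.src.shift p.ν, p.μ⟩ - Z ⟨p.src, p.ν⟩)‖ ≤ 4 * r + 13 * m ^ 2 := by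
  unfold GaugeField.plaqHol
  exact norm_plaqProd_sub_one_sub_curl_le V Z p.src p.μ p.ν hm1 (hV _) (hV _) (hV _) (hV _) (hZ _) (hZ _) (hZ _) (hZ _)

/-- **`dist1` COMPANION, UPPER**: `|V(∂p) − 1| ≤ ‖curl Z(p)‖ + 4r + 13m²`. [cite: Balaban1985Averaging, (9) p.19, (19) p.21] -/
theorem dist1_plaqHol_le_norm_curl_add (V : GaugeField P j (Matrix.specialUnitaryGroup n ℂ)) (Z : PBond P j → Matrix n n ℂ)
    (p : Plaq P j) {m r : ℝ} (hm1 : m ≤ 1)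
    (hV : ∀ b : PBond P j, ‖((V b : Matrix.specialUnitaryGroup n ℂ) : Matrix n n ℂ) - 1‖ ≤ m)
    (hZ : ∀ b : PBond P j, ‖((V b : Matrix.specialUnitaryGroup n ℂ) : Matrix n n ℂ) - 1 - Z b‖ ≤ r) :
    GaugeGroup.dist1 (GaugeField.plaqHol V p) ≤
      ‖Z ⟨p.src, p.μ⟩ + Z ⟨p.src.shift p.μ, p.ν⟩ - Z ⟨p.src.shift p.ν, p.μ⟩ - Z ⟨p.src, p.ν⟩‖ + (4 * r + 13 * m ^ 2) := by
  have h := norm_plaqHol_sub_one_sub_curl_le V Z p hm1 hV hZ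
  rw [dist1_SU_eq]
  exact (norm_le_insert' _ _).trans (by linarith)

/-- **`dist1` COMPANION, LOWER**: `‖curl Z(p)‖ ≤ |V(∂p) − 1| + 4r + 13m²`. [cite: Balaban1985Averaging, (9) p.19, (19) p.21] -/
theorem norm_curl_le_dist1_plaqHol_add (V : GaugeField P j (Matrix.specialUnitaryGroup n ℂ)) (Z : PBond P j → Matrix n n ℂ)
    (p : Plaq P j) {m r : ℝ} (hm1 : m ≤ 1)
    (hV : ∀ b : PBond P j, ‖((V b : Matrix.specialUnitaryGroup n ℂ) : Matrix n n ℂ) - 1‖ ≤ m)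
    (hZ : ∀ b : PBond P j, ‖((V b : Matrix.specialUnitaryGroup n ℂ) : Matrix n n ℂ) - 1 - Z b‖ ≤ r) :
    ‖Z ⟨p.src, p.μ⟩ + Z ⟨p.src.shift p.μ, p.ν⟩ - Z ⟨p.src.shift p.ν, p.μ⟩ - Z ⟨p.src, p.ν⟩‖ ≤
      GaugeGroup.dist1 (GaugeField.plaqHol V p) + (4 * r + 13 * m ^ 2) := by
  have h := norm_plaqHol_sub_one_sub_curl_le V Z p hm1 hV hZ
  rw [dist1_SU_eq]
  exact (norm_le_insert _ _).trans (by linarith)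

omit [Nonempty n] in
/-- **★ THE FINE PLAQUETTES**: for a field with `‖U(b) − 1‖ ≤ δ ≤ 1` on the four bonds of `(y; μ, ν)` and `Y = U − 1`, the unit plaquette circulation of `Y` is the field's own
plaquette deviation to second order: `‖Y(y,μ) + Y(y+e_μ,ν) − Y(y+e_ν,μ) − Y(y,ν)‖ ≤ ‖U(y,μ)U(y+e_μ,ν)U(y+e_ν,μ)⁻¹U(y,ν)⁻¹ − 1‖ + 13δ²` (either orientation).
[cite: Balaban1985Averaging, (9) p.19, Prop. 1 (48)–(50) p.25] -/
theorem norm_fineCurl_le_dist1_add (U : GaugeField P j (Matrix.specialUnitaryGroup n ℂ)) (y : Site P j) (μ ν : Fin P.d) {δ : ℝ} (hδ1 : δ ≤ 1)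
    (h₁ : ‖((U ⟨y, μ⟩ : Matrix.specialUnitaryGroup n ℂ) : Matrix n n ℂ) - 1‖ ≤ δ)
    (h₂ : ‖((U ⟨y.shift μ, ν⟩ : Matrix.specialUnitaryGroup n ℂ) : Matrix n n ℂ) - 1‖ ≤ δ)
    (h₃ : ‖((U ⟨y.shift ν, μ⟩ : Matrix.specialUnitaryGroup n ℂ) : Matrix n n ℂ) - 1‖ ≤ δ)
    (h₄ : ‖((U ⟨y, ν⟩ : Matrix.specialUnitaryGroup n ℂ) : Matrix n n ℂ) - 1‖ ≤ δ) :
    ‖(((U ⟨y, μ⟩ : Matrix.specialUnitaryGroup n ℂ) : Matrix n n ℂ) - 1) + (((U ⟨y.shift μ, ν⟩ : Matrix.specialUnitaryGroup n ℂ) : Matrix n n ℂ) - 1) -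
        (((U ⟨y.shift ν, μ⟩ : Matrix.specialUnitaryGroup n ℂ) : Matrix n n ℂ) - 1) - (((U ⟨y, ν⟩ : Matrix.specialUnitaryGroup n ℂ) : Matrix n n ℂ) - 1)‖ ≤
      ‖((U ⟨y, μ⟩ * U ⟨y.shift μ, ν⟩ * (U ⟨y.shift ν, μ⟩)⁻¹ * (U ⟨y, ν⟩)⁻¹ : Matrix.specialUnitaryGroup n ℂ) : Matrix n n ℂ) - 1‖ + 13 * δ ^ 2 := by
  set Y : PBond P j → Matrix n n ℂ := fun b => ((U b : Matrix.specialUnitaryGroup n ℂ) : Matrix n n ℂ) - 1 with hY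
  have hz : ∀ b : PBond P j, ‖((U b : Matrix.specialUnitaryGroup n ℂ) : Matrix n n ℂ) - 1 - Y b‖ ≤ 0 := fun b => by
    simp only [hY, sub_self, norm_zero, le_refl]
  have h := norm_plaqProd_sub_one_sub_curl_le U Y y μ ν hδ1 h₁ h₂ h₃ h₄ (hz _) (hz _) (hz _) (hz _)
  change ‖Y ⟨y, μ⟩ + Y ⟨y.shift μ, ν⟩ - Y ⟨y.shift ν, μ⟩ - Y ⟨y, ν⟩‖ ≤ _
  exact (norm_le_insert _ _).trans (by linarith)

omit [Nonempty n] in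
/-- **THE SUMMED FINE BOUND** over any finite family of fine plaquettes `t ↦ (y_t; μ_t, ν_t)` of a field with `‖U(b) − 1‖ ≤ δ ≤ 1` everywhere:
`Σ_{t∈T} ‖curl Y(t)‖ ≤ Σ_{t∈T} ‖U(∂t) − 1‖ + 13·|T|·δ²`. [cite: Balaban1985UV3, (69) p.273; Balaban1985Averaging, Prop. 1 (48)–(51) pp.25–26] -/
theorem sum_norm_fineCurl_le {ι : Type*} (T : Finset ι) (yf : ι → Site P j) (μf νf : ι → Fin P.d)
    (U : GaugeField P j (Matrix.specialUnitaryGroup n ℂ)) {δ : ℝ} (hδ1 : δ ≤ 1)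
    (hU : ∀ b : PBond P j, ‖((U b : Matrix.specialUnitaryGroup n ℂ) : Matrix n n ℂ) - 1‖ ≤ δ) :
    ∑ t ∈ T, ‖(((U ⟨yf t, μf t⟩ : Matrix.specialUnitaryGroup n ℂ) : Matrix n n ℂ) - 1) + (((U ⟨(yf t).shift (μf t), νf t⟩ : Matrix.specialUnitaryGroup n ℂ) : Matrix n n ℂ) - 1) -
        (((U ⟨(yf t).shift (νf t), μf t⟩ : Matrix.specialUnitaryGroup n ℂ) : Matrix n n ℂ) - 1) - (((U ⟨yf t, νf t⟩ : Matrix.specialUnitaryGroup n ℂ) : Matrix n n ℂ) - 1)‖ ≤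
      ∑ t ∈ T, ‖((U ⟨yf t, μf t⟩ * U ⟨(yf t).shift (μf t), νf t⟩ * (U ⟨(yf t).shift (νf t), μf t⟩)⁻¹ * (U ⟨yf t, νf t⟩)⁻¹ : Matrix.specialUnitaryGroup n ℂ) :
          Matrix n n ℂ) - 1‖ + 13 * (T.card : ℝ) * δ ^ 2 := by
  have h := Finset.sum_le_sum (s := T) fun t _ => norm_fineCurl_le_dist1_add U (yf t) (μf t) (νf t) hδ1 (hU _) (hU _) (hU _) (hU _)
  refine h.trans (le_of_eq ?_)
  rw [Finset.sum_add_distrib, Finset.sum_const, nsmul_eq_mul]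
  ring

end Plaquette

/-! ## §3 The plaquette variable of the `s`-fold (0.4)-average of record, to second order about the curl of `Q^{(s)}Y`, `k`-UNIFORMLY -/

section Uniform

variable {P : Params} {n : Type*} [Fintype n] [DecidableEq n] [Nonempty n]

/-- **★★ [Balaban1985Averaging] PROP. 4 READ ON PLAQUETTES, `k`-UNIFORM** (flat gauge; hypotheses EXACTLY those of ✓ `EMLIterUniform.norm_iter_sub_one_sub_iterLin_le_uniform`): for every
`s ≤ k` and every level-`s` corner∕direction pair `(y; μ, ν)` (either orientation), with `m_s = 2|n|²(d+1)L^sδ`, `C = 324L(d+2)²`,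
`‖Ū^{(s)}(y,μ)Ū^{(s)}(y+e_μ,ν)Ū^{(s)}(y+e_ν,μ)⁻¹Ū^{(s)}(y,ν)⁻¹ − 1 − ((Q^{(s)}Y)(y,μ) + (Q^{(s)}Y)(y+e_μ,ν) − (Q^{(s)}Y)(y+e_ν,μ) − (Q^{(s)}Y)(y,ν))‖ ≤ (4C + 52)·m_s²` — the
average's plaquette IS the curl of the linearised average to second order on the natural scale, with a constant independent of `s` and `k`.
[cite: Balaban1985Averaging, Prop. 4 (134)–(135) p.38, (9) p.19; Balaban1987RG1, (0.4) p.253] -/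
theorem norm_plaqProd_iter_sub_one_sub_curl_le_uniform
    (Q : (i : ℕ) → (PBond P 0 → Matrix n n ℂ) → PBond P i → Matrix n n ℂ)
    (hQ0 : ∀ Y, Q 0 Y = Y) (hQs : ∀ (i : ℕ) (Y : PBond P 0 → Matrix n n ℂ) (c : PBond P (i + 1)), Q (i + 1) Y c = linAvg (Q i Y) c)
    (hL : P.d + 2 ≤ P.L) (U : GaugeField P 0 (Matrix.specialUnitaryGroup n ℂ)) {δ : ℝ} (hδ : 0 ≤ δ)
    (hU : ∀ b, ‖((U b : Matrix.specialUnitaryGroup n ℂ) : Matrix n n ℂ) - 1‖ ≤ δ) (k : ℕ)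
    (hm : 324 * (P.L : ℝ) * ((P.d : ℝ) + 2) ^ 2 * (2 * (Fintype.card n : ℝ) ^ 2 * (((P.d : ℝ) + 1) * (P.L : ℝ) ^ k * δ)) ≤ 1)
    (hN : 4 * (((P.d + 2) * P.L : ℕ) : ℝ) * (2 * (Fintype.card n : ℝ) ^ 2 * (((P.d : ℝ) + 1) * (P.L : ℝ) ^ k * δ)) < deltaSU n)
    (s : ℕ) (hs : s ≤ k) (y : Site P s) (μ ν : Fin P.d) :
    ‖((Averaging.iter (fun i => blockAvg (P := P) (j := i) (expMeanLogSU (n := n))) s U ⟨y, μ⟩ *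
          Averaging.iter (fun i => blockAvg (P := P) (j := i) (expMeanLogSU (n := n))) s U ⟨y.shift μ, ν⟩ *
          (Averaging.iter (fun i => blockAvg (P := P) (j := i) (expMeanLogSU (n := n))) s U ⟨y.shift ν, μ⟩)⁻¹ *
          (Averaging.iter (fun i => blockAvg (P := P) (j := i) (expMeanLogSU (n := n))) s U ⟨y, ν⟩)⁻¹ : Matrix.specialUnitaryGroup n ℂ) : Matrix n n ℂ) - 1 -
        (Q s (fun b => ((U b : Matrix.specialUnitaryGroup n ℂ) : Matrix n n ℂ) - 1) ⟨y, μ⟩ +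
          Q s (fun b => ((U b : Matrix.specialUnitaryGroup n ℂ) : Matrix n n ℂ) - 1) ⟨y.shift μ, ν⟩ -
          Q s (fun b => ((U b : Matrix.specialUnitaryGroup n ℂ) : Matrix n n ℂ) - 1) ⟨y.shift ν, μ⟩ -
          Q s (fun b => ((U b : Matrix.specialUnitaryGroup n ℂ) : Matrix n n ℂ) - 1) ⟨y, ν⟩)‖ ≤
      (4 * (324 * (P.L : ℝ) * ((P.d : ℝ) + 2) ^ 2) + 52) * (2 * (Fintype.card n : ℝ) ^ 2 * (((P.d : ℝ) + 1) * (P.L : ℝ) ^ s * δ)) ^ 2 := by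
  -- letters
  set C : ℝ := 324 * (P.L : ℝ) * ((P.d : ℝ) + 2) ^ 2 with hC
  set ms : ℝ := 2 * (Fintype.card n : ℝ) ^ 2 * (((P.d : ℝ) + 1) * (P.L : ℝ) ^ s * δ) with hms
  have key := norm_iter_sub_one_sub_iterLin_le_uniform Q hQ0 hQs hL U hδ hU k hm hN s hs
  -- sizes: `C·m_s ≤ 1`, `C ≥ 324`, so `2 m_s ≤ 1`
  have hmono : ms ≤ 2 * (Fintype.card n : ℝ) ^ 2 * (((P.d : ℝ) + 1) * (P.L : ℝ) ^ k * δ) := main_scale_mono (n := n) hδ hs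
  have hC0 : 0 ≤ C := by positivity
  have hCm : C * ms ≤ 1 := (mul_le_mul_of_nonneg_left hmono hC0).trans hm
  have hms0 : 0 ≤ ms := by positivity
  have hC324 : 324 ≤ C := by
    have hL1 : (1 : ℝ) ≤ P.L := by exact_mod_cast P.hL.2.le
    have hd2 : (1 : ℝ) ≤ ((P.d : ℝ) + 2) ^ 2 := by
      have : (1 : ℝ) ≤ (P.d : ℝ) + 2 := by have := (Nat.cast_nonneg P.d : (0 : ℝ) ≤ P.d); linarith
      nlinarith
    rw [hC]; nlinarith
  have h2m : 2 * ms ≤ 1 := by nlinarith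
  -- the four bonds
  have hV : ∀ b : PBond P s, ‖((Averaging.iter (fun i => blockAvg (P := P) (j := i) (expMeanLogSU (n := n))) s U b :
      Matrix.specialUnitaryGroup n ℂ) : Matrix n n ℂ) - 1‖ ≤ 2 * ms := fun b => (key b).1
  have hZ : ∀ b : PBond P s, ‖((Averaging.iter (fun i => blockAvg (P := P) (j := i) (expMeanLogSU (n := n))) s U b :
      Matrix.specialUnitaryGroup n ℂ) : Matrix n n ℂ) - 1 - Q s (fun b => ((U b : Matrix.specialUnitaryGroup n ℂ) : Matrix n n ℂ) - 1) b‖ ≤ C * ms ^ 2 :=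
    fun b => (key b).2
  have h := norm_plaqProd_sub_one_sub_curl_le (Averaging.iter (fun i => blockAvg (P := P) (j := i) (expMeanLogSU (n := n))) s U)
    (Q s (fun b => ((U b : Matrix.specialUnitaryGroup n ℂ) : Matrix n n ℂ) - 1)) y μ ν h2m
    (hV _) (hV _) (hV _) (hV _) (hZ _) (hZ _) (hZ _) (hZ _)
  refine h.trans (le_of_eq ?_)
  ring

/-- **★ `dist1` FORM AT A PLAQUETTE OF THE TREE**: `|Ū^{(s)}(∂p′) − 1| ≤ ‖curl(Q^{(s)}Y)(p′)‖ + (4C + 52)·m_s²` for every `s ≤ k`, `p′ : Plaq P s` — the left side is LETTER FOR LETTER the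
quantity recorded by `AlphaInputsT3AC.large67RecSet` (at `n = Fin 2`, `ℰp = expMeanLogSU`). [cite: Balaban1985UV3, (67)+(69) p.273; Balaban1985Averaging, Prop. 4 (134)–(135) p.38] -/
theorem dist1_plaqHol_iter_le_uniform
    (Q : (i : ℕ) → (PBond P 0 → Matrix n n ℂ) → PBond P i → Matrix n n ℂ)
    (hQ0 : ∀ Y, Q 0 Y = Y) (hQs : ∀ (i : ℕ) (Y : PBond P 0 → Matrix n n ℂ) (c : PBond P (i + 1)), Q (i + 1) Y c = linAvg (Q i Y) c)
    (hL : P.d + 2 ≤ P.L) (U : GaugeField P 0 (Matrix.specialUnitaryGroup n ℂ)) {δ : ℝ} (hδ : 0 ≤ δ)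
    (hU : ∀ b, ‖((U b : Matrix.specialUnitaryGroup n ℂ) : Matrix n n ℂ) - 1‖ ≤ δ) (k : ℕ)
    (hm : 324 * (P.L : ℝ) * ((P.d : ℝ) + 2) ^ 2 * (2 * (Fintype.card n : ℝ) ^ 2 * (((P.d : ℝ) + 1) * (P.L : ℝ) ^ k * δ)) ≤ 1)
    (hN : 4 * (((P.d + 2) * P.L : ℕ) : ℝ) * (2 * (Fintype.card n : ℝ) ^ 2 * (((P.d : ℝ) + 1) * (P.L : ℝ) ^ k * δ)) < deltaSU n)
    (s : ℕ) (hs : s ≤ k) (p : Plaq P s) :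
    GaugeGroup.dist1 (GaugeField.plaqHol (Averaging.iter (fun i => blockAvg (P := P) (j := i) (expMeanLogSU (n := n))) s U) p) ≤
      ‖Q s (fun b => ((U b : Matrix.specialUnitaryGroup n ℂ) : Matrix n n ℂ) - 1) ⟨p.src, p.μ⟩ +
          Q s (fun b => ((U b : Matrix.specialUnitaryGroup n ℂ) : Matrix n n ℂ) - 1) ⟨p.src.shift p.μ, p.ν⟩ -
          Q s (fun b => ((U b : Matrix.specialUnitaryGroup n ℂ) : Matrix n n ℂ) - 1) ⟨p.src.shift p.ν, p.μ⟩ -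
          Q s (fun b => ((U b : Matrix.specialUnitaryGroup n ℂ) : Matrix n n ℂ) - 1) ⟨p.src, p.ν⟩‖ +
      (4 * (324 * (P.L : ℝ) * ((P.d : ℝ) + 2) ^ 2) + 52) * (2 * (Fintype.card n : ℝ) ^ 2 * (((P.d : ℝ) + 1) * (P.L : ℝ) ^ s * δ)) ^ 2 := by
  have h := norm_plaqProd_iter_sub_one_sub_curl_le_uniform Q hQ0 hQs hL U hδ hU k hm hN s hs p.src p.μ p.ν
  rw [dist1_SU_eq]
  unfold GaugeField.plaqHol
  exact (norm_le_insert' _ _).trans (by linarith)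

end Uniform

/-! ## §4 (69)_sym modulo the rigid flux of the iterated linearised average (piece (i), displayed as `hflux`) -/

section Knit

variable {P : Params} {n : Type*} [Fintype n] [DecidableEq n] [Nonempty n]

/-- **★★ (69)_sym MODULO THE RIGID FLUX.**  Under the hypotheses of §3, let `p′ : Plaq P s`, `s ≤ k`, and suppose the curl of the `s`-fold linearised average around `p′` is controlled
by a weighted sum of unit fine-plaquette circulations of `Y = U − 1` over a finite family `t ↦ (y_t; μ_t, ν_t)` (piece (i): for print's block average this is an IDENTITY with
`w = L^{−ds}` over the `L^{ds}·L^{2s}` sub-plaquettes of the translates of `p′`, [Balaban1985UV3] (69); displayed here as the inequality `hflux`, `0 ≤ w`).  Then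
`|Ū^{(s)}(∂p′) − 1| ≤ w·Σ_t |U(∂t) − 1| + 13·w·|T|·δ² + (4·324L(d+2)² + 52)·m_s²` — print's (69) for the SYMMETRIC average, the large quantity bounded by the block sum of fine
plaquette deviations plus remainders quadratic on the natural scale. [cite: Balaban1985UV3, (69) p.273; Balaban1985Averaging, Prop. 1 (48)–(51) pp.25–26, Prop. 4 (134)–(135) p.38] -/
theorem dist1_plaqHol_iter_le_of_flux
    (Q : (i : ℕ) → (PBond P 0 → Matrix n n ℂ) → PBond P i → Matrix n n ℂ)
    (hQ0 : ∀ Y, Q 0 Y = Y) (hQs : ∀ (i : ℕ) (Y : PBond P 0 → Matrix n n ℂ) (c : PBond P (i + 1)), Q (i + 1) Y c = linAvg (Q i Y) c)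
    (hL : P.d + 2 ≤ P.L) (U : GaugeField P 0 (Matrix.specialUnitaryGroup n ℂ)) {δ : ℝ} (hδ : 0 ≤ δ) (hδ1 : δ ≤ 1)
    (hU : ∀ b, ‖((U b : Matrix.specialUnitaryGroup n ℂ) : Matrix n n ℂ) - 1‖ ≤ δ) (k : ℕ)
    (hm : 324 * (P.L : ℝ) * ((P.d : ℝ) + 2) ^ 2 * (2 * (Fintype.card n : ℝ) ^ 2 * (((P.d : ℝ) + 1) * (P.L : ℝ) ^ k * δ)) ≤ 1)
    (hN : 4 * (((P.d + 2) * P.L : ℕ) : ℝ) * (2 * (Fintype.card n : ℝ) ^ 2 * (((P.d : ℝ) + 1) * (P.L : ℝ) ^ k * δ)) < deltaSU n)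
    (s : ℕ) (hs : s ≤ k) (p : Plaq P s)
    {ι : Type*} (T : Finset ι) (yf : ι → Site P 0) (μf νf : ι → Fin P.d) {w : ℝ} (hw : 0 ≤ w)
    (hflux : ‖Q s (fun b => ((U b : Matrix.specialUnitaryGroup n ℂ) : Matrix n n ℂ) - 1) ⟨p.src, p.μ⟩ +
          Q s (fun b => ((U b : Matrix.specialUnitaryGroup n ℂ) : Matrix n n ℂ) - 1) ⟨p.src.shift p.μ, p.ν⟩ -
          Q s (fun b => ((U b : Matrix.specialUnitaryGroup n ℂ) : Matrix n n ℂ) - 1) ⟨p.src.shift p.ν, p.μ⟩ -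
          Q s (fun b => ((U b : Matrix.specialUnitaryGroup n ℂ) : Matrix n n ℂ) - 1) ⟨p.src, p.ν⟩‖ ≤
      w * ∑ t ∈ T, ‖(((U ⟨yf t, μf t⟩ : Matrix.specialUnitaryGroup n ℂ) : Matrix n n ℂ) - 1) +
          (((U ⟨(yf t).shift (μf t), νf t⟩ : Matrix.specialUnitaryGroup n ℂ) : Matrix n n ℂ) - 1) -
          (((U ⟨(yf t).shift (νf t), μf t⟩ : Matrix.specialUnitaryGroup n ℂ) : Matrix n n ℂ) - 1) -
          (((U ⟨yf t, νf t⟩ : Matrix.specialUnitaryGroup n ℂ) : Matrix n n ℂ) - 1)‖) :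
    GaugeGroup.dist1 (GaugeField.plaqHol (Averaging.iter (fun i => blockAvg (P := P) (j := i) (expMeanLogSU (n := n))) s U) p) ≤
      w * ∑ t ∈ T, ‖((U ⟨yf t, μf t⟩ * U ⟨(yf t).shift (μf t), νf t⟩ * (U ⟨(yf t).shift (νf t), μf t⟩)⁻¹ * (U ⟨yf t, νf t⟩)⁻¹ :
          Matrix.specialUnitaryGroup n ℂ) : Matrix n n ℂ) - 1‖ +
      13 * w * (T.card : ℝ) * δ ^ 2 +
      (4 * (324 * (P.L : ℝ) * ((P.d : ℝ) + 2) ^ 2) + 52) * (2 * (Fintype.card n : ℝ) ^ 2 * (((P.d : ℝ) + 1) * (P.L : ℝ) ^ s * δ)) ^ 2 := by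
  have h1 := dist1_plaqHol_iter_le_uniform Q hQ0 hQs hL U hδ hU k hm hN s hs p
  have h2 := sum_norm_fineCurl_le T yf μf νf U hδ1 hU
  have h3 := mul_le_mul_of_nonneg_left h2 hw
  have e : w * (∑ t ∈ T, ‖((U ⟨yf t, μf t⟩ * U ⟨(yf t).shift (μf t), νf t⟩ * (U ⟨(yf t).shift (νf t), μf t⟩)⁻¹ * (U ⟨yf t, νf t⟩)⁻¹ :
          Matrix.specialUnitaryGroup n ℂ) : Matrix n n ℂ) - 1‖ + 13 * (T.card : ℝ) * δ ^ 2) =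
      w * ∑ t ∈ T, ‖((U ⟨yf t, μf t⟩ * U ⟨(yf t).shift (μf t), νf t⟩ * (U ⟨(yf t).shift (νf t), μf t⟩)⁻¹ * (U ⟨yf t, νf t⟩)⁻¹ :
          Matrix.specialUnitaryGroup n ℂ) : Matrix n n ℂ) - 1‖ + 13 * w * (T.card : ℝ) * δ ^ 2 := by ring
  rw [e] at h3
  linarith

end Knit

end Summit.QuantumFields.YangMills.Theorems.SymAvgPlaqAssembly

end
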